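import Summits.CriticalPhenomena.PercolationContinuityZ3.Theses.PercBurnResprinkle
import Literature.Probability.Percolation.PercolationProofs

/-!
# Triage scratch (crux-triage r1, triager 3) — the shared monotone core of the planar cards

Sorry-free proofs of the two "planar witness ⇒ crux" first lemmas, with the definitions copied
VERBATIM from the ideators' sketches:
* `planarWitnessReduction` = `PlanarWitnessReduction` of `Sketch-ideator3.lean` (card planar-trace-sharpness);
* `crux_of_planar_localVacant` of card planar-trace-circuits' `Sketch.lean` (`Armed`, `localVacant`, `plane`).
These are the cheap halves; nothing here touches the open inputs of the cards.  NOT a candidate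
proof of the crux.
-/

namespace TriageScratch2

open Literature.Probability.Percolation Literature.Probability.LatticeModels MeasureTheory

abbrev V3 : Type := Site 3

/-- verbatim from Sketch-ideator3.lean -/
def vacantSet (ω : BondConfig V3) : Set V3 := {y | (openCluster ω y).Finite}
/-- verbatim from Sketch-ideator3.lean -/
def plane0 : Set V3 := {x | x 0 = 0}
/-- verbatim from Sketch-ideator3.lean -/
def planarVacantConfig (ω : BondConfig V3) : BondConfig V3 :=
  {e | e ∈ (zdGraph 3).edgeSet ∧ ∀ y ∈ e, y ∈ plane0 ∧ y ∈ vacantSet ω}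
/-- verbatim from Sketch-ideator3.lean -/
def PlanarWitnessReduction : Prop :=
  (∃ p : unitInterval, criticalProb (zdGraph 3) (0 : V3) < (p : ℝ) ∧
      0 < (bondPercolation (zdGraph 3) p).real {ω | (openCluster (planarVacantConfig ω) (0 : V3)).Infinite})
    → Summit.CriticalPhenomena.PercolationContinuityZ3.Theses.PercBurnResprinkle.VacantSetPercolates

/-- The crux's inline configuration: all lattice edges between vacant vertices. -/
def cruxConfig (ω : BondConfig V3) : BondConfig V3 :=
  {e | e ∈ (zdGraph 3).edgeSet ∧ ∀ y ∈ e, ¬ (openCluster ω y).Infinite}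

theorem planarVacantConfig_subset (ω : BondConfig V3) : planarVacantConfig ω ⊆ cruxConfig ω := by
  intro e he
  exact ⟨he.1, fun y hy => Set.not_infinite.2 (he.2 y hy).2⟩

/-- First lemma of card planar-trace-sharpness, PROVED. -/
theorem planarWitnessReduction : PlanarWitnessReduction := by
  rintro ⟨p, hpc, hpos⟩
  refine ⟨p, hpc, hpos.trans_le (measureReal_mono ?_ (measure_ne_top _ _))⟩
  intro ω hω
  exact Set.Infinite.mono (openCluster_mono (planarVacantConfig_subset ω) 0) hω

/-! ### Card planar-trace-circuits: the locally-vacant planar witness -/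

/-- verbatim from card planar-trace-circuits (Sketch.lean) -/
def Armed (R : ℕ) (ω : BondConfig (Site 3)) (x : Site 3) : Prop :=
  ∃ y ∈ openCluster ω x, ∃ i : Fin 3, (R : ℤ) ≤ |y i - x i|
/-- verbatim from card planar-trace-circuits (Sketch.lean) -/
def localVacant (R : ℕ) (ω : BondConfig (Site 3)) : Set (Site 3) := {x | ¬ Armed R ω x}
/-- verbatim from card planar-trace-circuits (Sketch.lean) -/
def plane (h : ℤ) : Set (Site 3) := {x | x 0 = h}

/-- An infinite open cluster is armed to every distance (`V_R ⊆ W`). -/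
theorem armed_of_infinite {R : ℕ} {ω : BondConfig V3} {x : V3} (h : (openCluster ω x).Infinite) :
    Armed R ω x := by
  by_contra hA
  simp only [Armed, not_exists, not_and, not_le] at hA
  apply h
  refine Set.Finite.subset (Set.Finite.pi (fun i : Fin 3 => Set.finite_Ioo (x i - R) (x i + R))) ?_
  intro y hy
  rw [Set.mem_univ_pi]
  intro i
  have hlt := abs_lt.1 (hA y hy i)
  exact ⟨by linarith [hlt.1], by linarith [hlt.2]⟩

theorem siteCluster_subset_openCluster_crux (R : ℕ) (ω : BondConfig V3) :
    siteCluster (zdGraph 3) (localVacant R ω ∩ plane 0) 0 ⊆ openCluster (cruxConfig ω) 0 := by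
  rintro y ⟨-, -, hreach⟩
  refine hreach.mono ?_
  intro a b hab
  rw [siteOpenGraph_adj] at hab
  obtain ⟨hadj, ha, hb⟩ := hab
  rw [openGraph_adj]
  refine ⟨⟨(SimpleGraph.mem_edgeSet _).2 hadj, ?_⟩, hadj.ne⟩
  intro z hz
  rcases Sym2.mem_iff.1 hz with rfl | rfl
  · exact fun hinf => ha.1 (armed_of_infinite hinf)
  · exact fun hinf => hb.1 (armed_of_infinite hinf)

/-- First lemma of card planar-trace-circuits (`crux_of_planar_localVacant`), PROVED. -/
theorem crux_of_planar_localVacant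
    (h : ∃ p : unitInterval, criticalProb (zdGraph 3) 0 < (p : ℝ) ∧ ∃ R : ℕ,
      0 < (bondPercolation (zdGraph 3) p).real
        {ω | (siteCluster (zdGraph 3) (localVacant R ω ∩ plane 0) 0).Infinite}) :
    Summit.CriticalPhenomena.PercolationContinuityZ3.Theses.PercBurnResprinkle.VacantSetPercolates := by
  obtain ⟨p, hpc, R, hpos⟩ := h
  refine ⟨p, hpc, hpos.trans_le (measureReal_mono ?_ (measure_ne_top _ _))⟩
  intro ω hω
  exact Set.Infinite.mono (siteCluster_subset_openCluster_crux R ω) hω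

end TriageScratch2
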